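import Summits.BirchSwinnertonDyer.BirchSwinnertonDyer.Theorems.GenusKolyvaginAtTwoCasselsTatePairingRat
import Literature.NumberTheory.EllipticCurves.ShaTorsion
import HarnessLib

/-!
# Route `GenusKolyvaginAtTwo`, crux #2 `GenusPrimitiveSupplyAtTwo` (stmt-BirchSwinnertonDyer-22136):
# THE KERNEL LEMMA at `2` — an odd Cassels–Tate form with `#Ш[2] ≤ 4` has `Ш[2] ∩ 2·Ш[4] = 0`

Width seat `bsd-line-gk2-p5` g16 (cell `bsd-f1-sign2`, SUPPLY lineage of crux 22136), file 42 of the series; prepares the row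
B⁰ `F1Sign2.OddBranchEggBitEqRadicalBitAtTwo` (its clause (K): «`θ = −` and rank `≥ 1` ⟹ the Cassels–Tate radical of
`Sel₂(W^{(d)})` is the Mordell–Weil line»). THEOREMS ONLY (no definition, no named fact, no `sorry`); helper
`--supports stmt-BirchSwinnertonDyer-22136`; no item is closed; BSD is not proved by any of this.

WHAT.
* §186 ALGEBRA (any abelian groups `T`, `Q`; `T` torsion; `B : T × T → Q` bi-additive ALTERNATING whose left-orthogonal
  elements are divisible — the kernel clause of the Cassels–Tate fact, no finiteness anywhere):
  `false_of_alternating_of_twoTorsion_subset_four` — it is IMPOSSIBLE that `T[2] ⊆ {0, s, t, s + t}` with `t = 2c ≠ 0`,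
  `4c = 0`, and `s ∉ 2·T[4]`.  Mechanism (elementary, NO structure theory of `2`-primary groups):
  (i) `2·T[4] ∩ T[2] = {0, t}` (`two_nsmul_eq_zero_or_eq_of_four_nsmul_eq_zero`);
  (ii) `t` is left-orthogonal to everything (`apply_two_nsmul_eq_zero_of_four_nsmul`): `B(2c, y) = B(c, u)`, `u = 2y`; if
  `ord u` is odd, `4` and `ord u` both kill `B(c,u)`; if `ord u = 2k`, then `w = k·y` has `4w = 0`, `2w = k·u ≠ 0`, so
  `2w = t = 2c` by (i), and `B(c, u) = B(w, u) + B(c − w, u) = k·2·B(y,y) + B(2(c−w), y) = 0`;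
  (iii) hence `t` is divisible; (iv) `s` is left-orthogonal to everything (`apply_eq_zero_of_not_mem_twice_four`, strong
  induction on `ord y`): `2·B(s,y) = 0`; `ord y` odd ⟹ `0`; `ord y = 2k`, `k` odd ⟹ `B(s,y) = B(s, k·y)` with
  `k·y ∈ T[2] ⊆ {0,s,t,s+t}`, all `B(s,·)`-null; `ord y = 4j` ⟹ `2j·y = t` by (i), `t = (4j)·z` by (iii), and
  `y − 2z` has smaller order and the same `B(s,·)` — induction; (v) so `s` is divisible, `s = 2z`, `4z = 0`: contradiction.
* §187 ARITHMETIC (every number field `K : Type`, every elliptic `V/K`; the Cassels–Tate fact is the tree THEOREM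
  `WeierstrassCurve.exists_casselsTate_pairing_holds`, gk2-p1 g13): `mem_zero_or_eq_of_natCard_le_four` (counting in a
  subgroup of order `≤ 4`) and **`sha_twoTorsion_eq_zero_of_twice_fourTorsion_of_natCard_le_four`** — if `#Ш(V/K)[2] ≤ 4`
  (finite) and SOME class of `Ш[2]` is not twice a class of `Ш[4]` (`θ(V) = −`), then NO non-zero class of `Ш[2]` is
  twice a class of `Ш[4]`: `Ш[2] ∩ 2·Ш[4] = 0`, i.e. the Cassels–Tate form on `Sel₂(V)` has radical exactly the Kummer image.

Honest framing: classical (Cassels 1962 §1: alternating, kernel = divisibles ⟹ on a finite `Ш[2^∞] ≅ L × L`; here the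
one consequence needed is extracted without finiteness or the structure theorem); kernel-new bookkeeping; beyond-print
theorem: no. Crux 22136 stays OPEN exactly at (U) 24947 ∧ (CONV₂) 19220/24948. BSD is not proved by any of this.

References: [Cassels1962ArithmeticIV] §1, Thm. 1.2; [SilvermanAEC2009] Thm. X.4.14; [MorganSmith2021CTP] Thm. 1.3 (left
kernel of `CT` on `Sel₂` is `π(Sel₄)`); [Kramer1981] Prop. 6.
-/

set_option linter.dupNamespace false -- tree convention: `Summit.BirchSwinnertonDyer.BirchSwinnertonDyer.Theorems` (summit = sub-problem)
set_option autoImplicit false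

noncomputable section

open scoped Classical

namespace Summit.BirchSwinnertonDyer.BirchSwinnertonDyer.Theorems.GenusKolyArch

/-! ## §186 Algebra: an alternating form with divisible kernel -/

section Algebra

variable {T Q : Type*} [AddCommGroup T] [AddCommGroup Q]

/-- Two annihilators `2` and an odd `n` kill: `2 • q = 0`, `n • q = 0`, `n` odd ⟹ `q = 0`. [folklore] -/
theorem eq_zero_of_two_nsmul_of_odd_nsmul {q : Q} {n : ℕ} (hn : Odd n) (h2 : 2 • q = 0) (hnq : n • q = 0) :
    q = 0 := by
  have h := Nat.dvd_gcd (addOrderOf_dvd_iff_nsmul_eq_zero.mpr h2) (addOrderOf_dvd_iff_nsmul_eq_zero.mpr hnq)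
  rw [Nat.Coprime.gcd_eq_one (Nat.coprime_two_left.mpr hn), Nat.dvd_one] at h
  exact AddMonoid.addOrderOf_eq_one_iff.mp h

/-- Two annihilators `4` and an odd `n` kill: `4 • q = 0`, `n • q = 0`, `n` odd ⟹ `q = 0`. [folklore] -/
theorem eq_zero_of_four_nsmul_of_odd_nsmul {q : Q} {n : ℕ} (hn : Odd n) (h4 : 4 • q = 0) (hnq : n • q = 0) :
    q = 0 := by
  have h := Nat.dvd_gcd (addOrderOf_dvd_iff_nsmul_eq_zero.mpr h4) (addOrderOf_dvd_iff_nsmul_eq_zero.mpr hnq)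
  have h4n : Nat.Coprime 4 n := by
    have : Nat.Coprime (2 ^ 2) n := Nat.Coprime.pow_left 2 (Nat.coprime_two_left.mpr hn)
    simpa using this
  rw [Nat.Coprime.gcd_eq_one h4n, Nat.dvd_one] at h
  exact AddMonoid.addOrderOf_eq_one_iff.mp h

/-- An odd multiple of a `2`-torsion element is the element: `2 • q = 0`, `k` odd ⟹ `k • q = q`. [folklore] -/
theorem odd_nsmul_eq_self_of_two_nsmul {q : Q} {k : ℕ} (hk : Odd k) (h2 : 2 • q = 0) : k • q = q := by
  obtain ⟨j, rfl⟩ := hk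
  rw [add_nsmul, one_nsmul, mul_nsmul, h2, nsmul_zero, zero_add]

variable (B : T →+ T →+ Q)

/-- Bi-additivity on the left in the form used below: `B (n • x) y = n • B x y`. [folklore] -/
theorem apply_nsmul_left (n : ℕ) (x y : T) : B (n • x) y = n • B x y := by
  rw [map_nsmul, AddMonoidHom.nsmul_apply]

/-- Moving a scalar across the form: `B (n • x) y = B x (n • y)`. [folklore] -/
theorem apply_nsmul_comm (n : ℕ) (x y : T) : B (n • x) y = B x (n • y) := by
  rw [apply_nsmul_left, map_nsmul]

variable {B} {s c : T}

/-- **(i) `2·T[4] ∩ T[2] = {0, t}`.** If `T[2] ⊆ {0, s, t, s + t}` with `t = 2 • c`, `4 • c = 0` and `s ∉ 2·T[4]`, then every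
`w` with `4 • w = 0` has `2 • w = 0` or `2 • w = 2 • c`. [folklore] -/
theorem two_nsmul_eq_zero_or_eq_of_four_nsmul_eq_zero (hc4 : 4 • c = 0)
    (hs : ∀ c' : T, 4 • c' = 0 → 2 • c' ≠ s)
    (h4 : ∀ x : T, 2 • x = 0 → x = 0 ∨ x = s ∨ x = 2 • c ∨ x = s + 2 • c)
    (w : T) (hw : 4 • w = 0) : 2 • w = 0 ∨ 2 • w = 2 • c := by
  have h2w : 2 • (2 • w) = 0 := by rw [← mul_nsmul', show 2 * 2 = 4 from rfl, hw]
  rcases h4 _ h2w with h | h | h | h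
  · exact Or.inl h
  · exact absurd h (hs w hw)
  · exact Or.inr h
  · exfalso
    refine hs (w - c) ?_ ?_
    · rw [nsmul_sub, hw, hc4, sub_zero]
    · rw [nsmul_sub, h, add_sub_cancel_right]

/-- **(ii) `t = 2 • c` is left-orthogonal to everything** (alternating `B`, torsion `T`, hypotheses of (i)). [folklore] -/
theorem apply_two_nsmul_eq_zero_of_four_nsmul (hT : AddMonoid.IsTorsion T) (halt : ∀ x, B x x = 0) (hc4 : 4 • c = 0)
    (hs : ∀ c' : T, 4 • c' = 0 → 2 • c' ≠ s)
    (h4 : ∀ x : T, 2 • x = 0 → x = 0 ∨ x = s ∨ x = 2 • c ∨ x = s + 2 • c) (y : T) :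
    B (2 • c) y = 0 := by
  rw [apply_nsmul_comm]
  set u : T := 2 • y with hu
  have h4cu : 4 • B c u = 0 := by rw [← apply_nsmul_left, hc4, map_zero, AddMonoidHom.zero_apply]
  set n : ℕ := addOrderOf u with hn
  have hnu : n • u = 0 := addOrderOf_nsmul_eq_zero u
  have hnpos : 0 < n := (hT u).addOrderOf_pos
  rcases Nat.even_or_odd n with heven | hodd
  · -- `n = 2k`: `w = k • y` has `4w = 0`, `2w = k • u ≠ 0`, hence `2w = 2c`
    obtain ⟨k, hk⟩ := heven
    have hkpos : 0 < k := by omega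
    have hkn : k < n := by omega
    set w : T := k • y with hw
    have h2w : 2 • w = k • u := by rw [hw, hu, ← mul_nsmul', ← mul_nsmul', mul_comm]
    have h4w : 4 • w = 0 := by
      rw [show (4 : ℕ) = 2 * 2 from rfl, mul_nsmul', h2w, ← mul_nsmul', show 2 * k = n by omega, hnu]
    have h2w0 : 2 • w ≠ 0 := by
      rw [h2w]
      exact nsmul_ne_zero_of_lt_addOrderOf hkpos.ne' (hn ▸ hkn)
    have h2wc : 2 • w = 2 • c :=
      (two_nsmul_eq_zero_or_eq_of_four_nsmul_eq_zero hc4 hs h4 w h4w).resolve_left h2w0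
    -- `B c u = B w u + B (c - w) u`, `B w u = k • 2 • B y y = 0`, `B (c - w) (2y) = B (2(c - w)) y = 0`
    have hcw : 2 • (c - w) = 0 := by rw [nsmul_sub, h2wc, sub_self]
    have e : c = w + (c - w) := by abel
    rw [e, map_add, AddMonoidHom.add_apply]
    have h1 : B w u = 0 := by
      rw [hw, hu, apply_nsmul_left, map_nsmul, halt, nsmul_zero, nsmul_zero]
    have h2 : B (c - w) u = 0 := by
      rw [hu, ← apply_nsmul_comm, hcw, map_zero, AddMonoidHom.zero_apply]
    rw [h1, h2, add_zero]
  · -- `n` odd: `4` and `n` both kill `B c u`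
    have hncu : n • B c u = 0 := by rw [← map_nsmul, hnu, map_zero]
    exact eq_zero_of_four_nsmul_of_odd_nsmul hodd h4cu hncu

/-- **(iv) `s` is left-orthogonal to everything** (alternating `B`, torsion `T`, left-orthogonal elements divisible,
hypotheses of (i)). [folklore] -/
theorem apply_eq_zero_of_not_mem_twice_four (hT : AddMonoid.IsTorsion T) (halt : ∀ x, B x x = 0)
    (hker : ∀ x : T, (∀ y, B x y = 0) → ∀ n : ℕ, 0 < n → ∃ z : T, n • z = x)
    (hs2 : 2 • s = 0) (hc4 : 4 • c = 0)
    (hs : ∀ c' : T, 4 • c' = 0 → 2 • c' ≠ s)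
    (h4 : ∀ x : T, 2 • x = 0 → x = 0 ∨ x = s ∨ x = 2 • c ∨ x = s + 2 • c) (y : T) :
    B s y = 0 := by
  -- `t = 2c` is divisible
  have htdiv : ∀ n : ℕ, 0 < n → ∃ z : T, n • z = 2 • c :=
    hker _ (apply_two_nsmul_eq_zero_of_four_nsmul hT halt hc4 hs h4)
  -- `B s` kills `T[2]`
  have hkill2 : ∀ x : T, 2 • x = 0 → B s x = 0 := by
    intro x hx
    have hst : B s (2 • c) = 0 := by rw [← apply_nsmul_comm, hs2, map_zero, AddMonoidHom.zero_apply]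
    rcases h4 x hx with h | h | h | h <;> rw [h]
    · exact map_zero _
    · exact halt s
    · exact hst
    · rw [map_add, halt s, hst, add_zero]
  -- strong induction on the order of `y`
  suffices h : ∀ (m : ℕ) (y : T), addOrderOf y = m → B s y = 0 from h _ y rfl
  intro m
  induction m using Nat.strong_induction_on with
  | _ m ih =>
    intro y hym
    by_contra hne
    have h2sy : 2 • B s y = 0 := by rw [← apply_nsmul_left, hs2, map_zero, AddMonoidHom.zero_apply]
    have hmpos : 0 < m := hym ▸ (hT y).addOrderOf_pos
    have hmy : m • y = 0 := hym ▸ addOrderOf_nsmul_eq_zero y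
    rcases Nat.even_or_odd m with heven | hodd
    · obtain ⟨k, hk⟩ := heven
      have hkpos : 0 < k := by omega
      have h2ky : 2 • (k • y) = 0 := by rw [← mul_nsmul', show 2 * k = m by omega, hmy]
      rcases Nat.even_or_odd k with hkeven | hkodd
      · -- `m = 4j`: `2j • y = t`, `t = m • z`, `y - 2z` has order `≤ 2j < m`
        obtain ⟨j, hj⟩ := hkeven
        have hjpos : 0 < j := by omega
        have h4jy : 4 • (j • y) = 0 := by rw [← mul_nsmul', show 4 * j = m by omega, hmy]
        have h2jy : 2 • (j • y) = k • y := by rw [← mul_nsmul', show 2 * j = k by omega]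
        have hky0 : k • y ≠ 0 := nsmul_ne_zero_of_lt_addOrderOf hkpos.ne' (by rw [hym]; omega)
        have hkyt : k • y = 2 • c := by
          rcases two_nsmul_eq_zero_or_eq_of_four_nsmul_eq_zero hc4 hs h4 (j • y) h4jy with h | h
          · exact absurd (h2jy ▸ h) hky0
          · rw [← h2jy, h]
        obtain ⟨z, hz⟩ := htdiv m hmpos
        set y' : T := y - 2 • z with hy'
        have hky' : k • y' = 0 := by
          rw [hy', nsmul_sub, hkyt, ← hz, ← mul_nsmul', show k * 2 = m by omega, sub_self]
        have hsy' : B s y' = B s y := by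
          rw [hy', map_sub, ← apply_nsmul_comm, hs2, map_zero, AddMonoidHom.zero_apply, sub_zero]
        have hlt : addOrderOf y' < m :=
          lt_of_le_of_lt (addOrderOf_le_of_nsmul_eq_zero hkpos hky') (by omega)
        exact hne (hsy' ▸ ih _ hlt y' rfl)
      · -- `m = 2k`, `k` odd: `k • y ∈ T[2]` and `B s (k • y) = B s y`
        have h1 : B s (k • y) = B s y := by
          rw [map_nsmul]
          exact odd_nsmul_eq_self_of_two_nsmul hkodd h2sy
        exact hne (h1 ▸ hkill2 _ h2ky)
    · have hmsy : m • B s y = 0 := by rw [← map_nsmul, hmy, map_zero]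
      exact hne (eq_zero_of_two_nsmul_of_odd_nsmul hodd h2sy hmsy)

/-- **§186 — THE KERNEL LEMMA (abstract).** Let `T` be a torsion abelian group with a bi-additive ALTERNATING form
`B : T × T → Q` whose left-orthogonal elements are divisible. Then it is impossible that `T[2] ⊆ {0, s, t, s + t}` with
`2 • s = 0`, `t = 2 • c`, `4 • c = 0` and `s` not of the form `2 • c'` with `4 • c' = 0` (for `t ≠ 0` this is the kernel
lemma; for `t = 0` it says an alternating divisible-kernel form cannot live on a `T` with `T[2] = {0, s}`, `s ∉ 2T`).  (For
`T = Ш(E)`: an odd Cassels–Tate form with `#Ш[2] ≤ 4` forces `Ш[2] ∩ 2Ш[4] = 0`.) [cite: Cassels1962ArithmeticIV, §1 and Thm 1.2] -/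
theorem false_of_alternating_of_twoTorsion_subset_four (hT : AddMonoid.IsTorsion T) (B : T →+ T →+ Q)
    (halt : ∀ x, B x x = 0) (hker : ∀ x : T, (∀ y, B x y = 0) → ∀ n : ℕ, 0 < n → ∃ z : T, n • z = x)
    {s c : T} (hs2 : 2 • s = 0) (hc4 : 4 • c = 0)
    (hs : ∀ c' : T, 4 • c' = 0 → 2 • c' ≠ s)
    (h4 : ∀ x : T, 2 • x = 0 → x = 0 ∨ x = s ∨ x = 2 • c ∨ x = s + 2 • c) : False := by
  obtain ⟨z, hz⟩ := hker s (apply_eq_zero_of_not_mem_twice_four hT halt hker hs2 hc4 hs h4) 2 two_pos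
  refine hs z ?_ hz
  rw [show (4 : ℕ) = 2 * 2 from rfl, mul_nsmul', hz, hs2]

end Algebra

/-! ## §187 Arithmetic: `Ш(V/K)[2] ∩ 2·Ш(V/K)[4] = 0` when `#Ш[2] ≤ 4` and `θ(V) = −` -/

section Arithmetic

/-- **Counting in a subgroup of order `≤ 4`.** If a finite subgroup `H` with `#H ≤ 4` contains `s ≠ 0`, `t ≠ 0`, `s ≠ t`
with `2 • t = 0`, then `H = {0, s, t, s + t}`. [folklore] -/
theorem mem_zero_or_eq_of_natCard_le_four {G : Type*} [AddCommGroup G] (H : AddSubgroup G) [Finite H]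
    (hH : Nat.card H ≤ 4) {s t : G} (hs : s ∈ H) (ht : t ∈ H) (hs0 : s ≠ 0) (ht0 : t ≠ 0) (hst : s ≠ t)
    (h2t : 2 • t = 0) (x : G) (hx : x ∈ H) : x = 0 ∨ x = s ∨ x = t ∨ x = s + t := by
  by_contra hne
  push Not at hne
  obtain ⟨hx0, hxs, hxt, hxst⟩ := hne
  have hnegt : -t = t := by
    rw [neg_eq_iff_add_eq_zero, ← two_nsmul, h2t]
  have hst0 : s + t ≠ 0 := fun h ↦ hst (by rw [add_eq_zero_iff_eq_neg, hnegt] at h; exact h)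
  have hsts : s + t ≠ s := fun h ↦ ht0 (by simpa using h)
  have hstt : s + t ≠ t := fun h ↦ hs0 (by simpa using h)
  -- the five elements `0, s, t, s + t, x` of `H` are pairwise distinct
  have hfin : (H : Set G).Finite := Set.toFinite _
  have h5 : ({0, s, t, s + t, x} : Set G).ncard = 5 := by
    rw [Set.ncard_insert_of_notMem, Set.ncard_insert_of_notMem, Set.ncard_insert_of_notMem, Set.ncard_pair hxst.symm]
    · simp only [Set.mem_insert_iff, Set.mem_singleton_iff, not_or]
      exact ⟨hstt.symm, hxt.symm⟩
    · simp only [Set.mem_insert_iff, Set.mem_singleton_iff, not_or]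
      exact ⟨hst, hsts.symm, hxs.symm⟩
    · simp only [Set.mem_insert_iff, Set.mem_singleton_iff, not_or]
      exact ⟨hs0.symm, ht0.symm, hst0.symm, hx0.symm⟩
  have hsub : ({0, s, t, s + t, x} : Set G) ⊆ (H : Set G) := by
    intro y hy
    simp only [Set.mem_insert_iff, Set.mem_singleton_iff] at hy
    rcases hy with rfl | rfl | rfl | rfl | rfl
    · exact H.zero_mem
    · exact hs
    · exact ht
    · exact H.add_mem hs ht
    · exact hx
  have hle := Set.ncard_le_ncard hsub hfin
  have hcard : (H : Set G).ncard = Nat.card H := (Nat.card_coe_set_eq (H : Set G)).symm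
  rw [h5, hcard] at hle
  omega

open _root_.WeierstrassCurve Literature.NumberTheory.EllipticCurves in
/-- **§187 — `Ш(V/K)[2] ∩ 2·Ш(V/K)[4] = 0` when the Cassels–Tate form is odd and `#Ш[2] ≤ 4`** (every number field
`K : Type`, every elliptic `V/K`; unconditional — the Cassels–Tate fact is the tree theorem
`WeierstrassCurve.exists_casselsTate_pairing_holds`). If `Ш(V/K)[2]` is finite of order `≤ 4` and SOME class of `Ш[2]` is
not twice a class of `Ш[4]` (`θ(V) = −`: the form on `Sel₂(V)` is not identically zero), then a class `t = 2 • c` of `Ш[2]`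
with `c ∈ Ш[4]` is `0` — i.e. the radical of the Cassels–Tate form on `Sel₂(V)` (MS21 Thm 1.3: the classes mapping to
`2·Ш[4]`) is exactly the Kummer image. §186 applied to `T = Ш(V/K)` (torsion, `isTorsion_sha`) and the counting lemma.
[cite: Cassels1962ArithmeticIV, §1 and Thm 1.2] [cite: MorganSmith2021CTP, Thm 1.3] [cite: SilvermanAEC2009, Thm. X.4.14] -/
theorem sha_two_nsmul_eq_zero_of_four_nsmul_of_natCard_le_four {K : Type} [Field K] [NumberField K]
    (V : WeierstrassCurve K) [V.IsElliptic]
    (hcard : Nat.card ↥(V.sha ⊓ AddSubgroup.torsionBy V.galH1 ((2 : ℕ) : ℤ)) ≤ 4)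
    (hcard0 : Nat.card ↥(V.sha ⊓ AddSubgroup.torsionBy V.galH1 ((2 : ℕ) : ℤ)) ≠ 0)
    (hodd : ¬ ∀ s ∈ V.sha, (2 : ℕ) • s = 0 → ∃ c' ∈ V.sha, (4 : ℕ) • c' = 0 ∧ (2 : ℕ) • c' = s)
    {c : V.galH1} (hc : c ∈ V.sha) (hc4 : (4 : ℕ) • c = 0) : (2 : ℕ) • c = 0 := by
  by_contra ht0
  push Not at hodd
  obtain ⟨s, hs, hs2, hsnot⟩ := hodd
  obtain ⟨B, halt, hker⟩ := exists_casselsTate_pairing_holds (K := K) V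
  haveI : Finite ↥(V.sha ⊓ AddSubgroup.torsionBy V.galH1 ((2 : ℕ) : ℤ)) := Nat.finite_of_card_ne_zero hcard0
  set H : AddSubgroup V.galH1 := V.sha ⊓ AddSubgroup.torsionBy V.galH1 ((2 : ℕ) : ℤ) with hH
  have hmemH : ∀ x : V.galH1, x ∈ H ↔ x ∈ V.sha ∧ (2 : ℕ) • x = 0 := fun x ↦ by
    rw [hH, AddSubgroup.mem_inf, AddSubgroup.torsionBy.nsmul_iff]
  have hs0 : s ≠ 0 := fun h ↦ hsnot 0 V.sha.zero_mem (nsmul_zero _) (by rw [nsmul_zero, h])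
  have ht2 : (2 : ℕ) • ((2 : ℕ) • c) = 0 := by rw [← mul_nsmul', show 2 * 2 = 4 from rfl, hc4]
  have hsH : s ∈ H := (hmemH s).mpr ⟨hs, hs2⟩
  have htH : (2 : ℕ) • c ∈ H := (hmemH _).mpr ⟨V.sha.nsmul_mem hc 2, ht2⟩
  have hst : s ≠ (2 : ℕ) • c := fun h ↦ hsnot c hc hc4 h.symm
  have henum := mem_zero_or_eq_of_natCard_le_four H hcard hsH htH hs0 ht0 hst ht2
  -- run §186 inside `T = Ш(V/K)`
  refine false_of_alternating_of_twoTorsion_subset_four (T := ↥V.sha) V.isTorsion_sha B halt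
    (fun x hx n hn ↦ (AddSubgroup.mem_divisibleElements_iff _ x).mp ((hker x).mp hx) n hn)
    (s := ⟨s, hs⟩) (c := ⟨c, hc⟩) (Subtype.ext hs2) (Subtype.ext hc4) (fun c' h4' h2' ↦ ?_) (fun x hx ↦ ?_)
  · exact hsnot c' c'.2 (congrArg Subtype.val h4') (congrArg Subtype.val h2')
  · have hx' : (x : V.galH1) ∈ H := (hmemH _).mpr ⟨x.2, congrArg Subtype.val hx⟩
    rcases henum x hx' with h | h | h | h
    · exact Or.inl (Subtype.ext h)
    · exact Or.inr (Or.inl (Subtype.ext h))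
    · exact Or.inr (Or.inr (Or.inl (Subtype.ext h)))
    · exact Or.inr (Or.inr (Or.inr (Subtype.ext h)))

end Arithmetic

end Summit.BirchSwinnertonDyer.BirchSwinnertonDyer.Theorems.GenusKolyArch

end
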